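import Literature.Algebra.EuclideanLattices.GaussianCosetSmoothing
import HarnessLib

/-!
# A discrete Gaussian above the smoothing parameter of a sublattice spreads evenly over its cosets

Topic `Algebra/EuclideanLattices` (family `pqc`), sequel of `GaussianCosetSmoothing.lean` (Regev 2009
Claim 3.8 / BLPRS 2013 Lemma 2.7: `(1-ε)/(1+ε) ρ_s(L) ≤ ρ_{s,c}(L) ≤ ρ_s(L)` for `s ≥ η_ε(L)`). The first
step of the analysis of Regev's BDD-to-LWE procedure (J. ACM 2009, proof of Lemma 3.4, arXiv version
p. 18; the core `R` of Peikert's Prop. 3.2, hypothesis `h₂` of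
`Literature.Computability.Cryptography.peikert_gapSVPZeta_to_lwe_classical_of_components`): "the
probability of obtaining each `a ∈ ℤ_pⁿ` is proportional to `ρ_r(pL + La)`. Using `η_ε(pL) = pη_ε(L) < r`
and Claim 3.8, the latter is `(r/p)ⁿ det(L*)(1 ± ε)`, which implies that the statistical distance between
the distribution of `a` and the uniform distribution is negligible." Abstractly: a discrete Gaussian on a
lattice `L` whose width exceeds the smoothing parameter of a full-rank SUBLATTICE `L' ≤ L` gives all
cosets of `L'` nearly the same probability. Everything is PROVED; no named fact.

## Results

* `cosetEquiv` (`t + L' ≃` the points of `L` in the coset), `discreteGaussian_toOuterMeasure_coset`: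
  `Pr_{D_{L,s,c}}[x ∈ t + L'] = ρ_{s,c-t}(L') · ρ_{s,c}(L)⁻¹` for `t ∈ L`.
* **`discreteGaussian_coset_le_mul_coset`** (relative form): for `0 < ε < 1`, `0 < s`, `η_ε(L') ≤ s`,
  `t, t' ∈ L`: `Pr[t + L'] ≤ (1+ε)/(1-ε) · Pr[t' + L']`.
* `sum_toOuterMeasure_cosets_eq_one` (a finite system of coset representatives partitions the mass),
  `le_div_card_and_inv_le_of_le_mul` (masses summing to `1` with pairwise ratio `≤ K` lie in
  `[(KN)⁻¹, K/N]`), and **`discreteGaussian_coset_near_uniform`** (absolute form): with `N` cosets,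
  each has probability in `[((1+ε)/(1-ε)·N)⁻¹, (1+ε)/(1-ε)·N⁻¹]`.

## Design

* Cosets are the events `{x : L | x - t ∈ L'}`; the system of representatives and the partition
  property are hypotheses (for `L' = qL`: `t_a = ∑ aᵢbᵢ`, `a ∈ {0,…,q-1}ⁿ`, `N = qⁿ`), so no quotient
  group or index computation is needed here.
* NOT here: the statistical-distance-to-uniform packaging (sum the absolute form over the `N` cosets:
  `Δ ≤ ε/(1-ε)`), the identification `L/qL ≅ ℤ_qⁿ`, and the rest of Lemma 3.4's analysis (Claim 3.9,
  Cor. 3.10: the second component of the sample).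

## References

* O. Regev, *On lattices, learning with errors, random linear codes, and cryptography*, J. ACM 56
  (2009), Claim 3.8 and the proof of Lemma 3.4 (arXiv:2401.03703, pp. 17–18) [RegevLWE2009].
* C. Peikert, *Public-key cryptosystems from the worst-case shortest vector problem*, STOC 2009,
  Prop. 3.2 and the sketch following it (full version p. 11) [Peikert2009].
* Z. Brakerski, A. Langlois, C. Peikert, O. Regev, D. Stehlé, *Classical hardness of learning with
  errors*, STOC 2013, Lemma 2.7 [BrakerskiEtAl2013].
-/

noncomputable section

open _root_.MeasureTheory Real
open scoped ENNReal

namespace Literature.Algebra.EuclideanLattices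

variable {E : Type*} [NormedAddCommGroup E] [InnerProductSpace ℝ E] [FiniteDimensional ℝ E]
  [MeasurableSpace E] [BorelSpace E]
variable (L L' : Submodule ℤ E) [DiscreteTopology L]

/-! ### The mass of a coset -/

/-- The points of `L` in the coset `t + L'` (`t ∈ L`, `L' ≤ L`) are the `t + y`, `y ∈ L'`: an
equivalence of index types for reindexing sums. [folklore] -/
def cosetEquiv (hL : L' ≤ L) {t : E} (ht : t ∈ L) :
    L' ≃ {x : L // (x : E) - t ∈ L'} where
  toFun y := ⟨⟨t + y, L.add_mem ht (hL y.2)⟩, by simp⟩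
  invFun x := ⟨(x : L) - t, x.2⟩
  left_inv y := by ext; simp
  right_inv x := by ext; simp

omit [MeasurableSpace E] [BorelSpace E] in
/-- **The `D_{L,s,c}`-probability of a coset**: for `t ∈ L` and `L' ≤ L`,
`Pr_{x ∼ D_{L,s,c}}[x ∈ t + L'] = ρ_{s,c-t}(L') · ρ_{s,c}(L)⁻¹` (`0 < s`). [cite: MicciancioRegev2007, §2] -/
theorem discreteGaussian_toOuterMeasure_coset (hL : L' ≤ L)
    {s : ℝ} (hs : 0 < s) (c : E) {t : E} (ht : t ∈ L) :
    (discreteGaussian L s c).toOuterMeasure {x | (x : E) - t ∈ L'} =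
      gaussianMass s (c - t) (L' : Set E) * (gaussianMass s c (L : Set E))⁻¹ := by
  rw [PMF.toOuterMeasure_apply, ← tsum_subtype, gaussianMass, ← ENNReal.tsum_mul_right]
  refine (Equiv.tsum_eq (cosetEquiv L L' hL ht)
    (fun x : {x : L // (x : E) - t ∈ L'} => discreteGaussian L s c x)).symm.trans ?_
  refine tsum_congr fun y => ?_
  rw [discreteGaussian_apply L hs]
  congr 3
  change (t + (y : E)) - c = (y : E) - (c - t)
  abel

variable [DiscreteTopology L'] [IsZLattice ℝ L']

/-- **Cosets of a smooth sublattice are almost equally likely** (the principle behind "`a` is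
essentially uniform since `r ≥ q · η_ε(Λ)`", Peikert 2009 p. 11 / Regev 2009, proof of Lemma 3.4 with
Claim 3.8, arXiv version p. 18: "the probability of obtaining each `a ∈ ℤ_pⁿ` is proportional to
`ρ_r(pL + La)` … `(r/p)ⁿ det(L*)(1 ± ε)`"): let `L' ≤ L` be lattices with `L'` of full
rank, `0 < ε < 1`, `0 < s` with `η_ε(L') ≤ s`, and any centre `c`. Then for all `t, t' ∈ L`,
`Pr_{D_{L,s,c}}[t + L'] ≤ (1+ε)/(1-ε) · Pr_{D_{L,s,c}}[t' + L']`: both are `ρ_{s,·}(L')/ρ_{s,c}(L)` for two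
centres, and `(1-ε)/(1+ε) ρ_s(L') ≤ ρ_{s,c'}(L') ≤ ρ_s(L')` for every centre `c'` (Regev 2009 Claim 3.8 /
BLPRS 2013 Lemma 2.7, the tree's `ofReal_mul_gaussianMass_lattice_le` and
`gaussianMass_le_gaussianMass_zero_of_discrete`). Summing over a system of coset representatives turns
this into `|Pr[t + L'] - [L:L']⁻¹| ≤ (2ε/(1-ε)) [L:L']⁻¹` for each coset (`discreteGaussian_coset_near_uniform`).
[cite: RegevLWE2009, proof of Lemma 3.4 (arXiv v. p. 18) with Claim 3.8] -/
theorem discreteGaussian_coset_le_mul_coset (hL : L' ≤ L) {ε s : ℝ} (hε : 0 < ε) (hε1 : ε < 1) (hs : 0 < s)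
    (hηs : smoothingParameter L' ε ≤ s) (c : E) {t t' : E} (ht : t ∈ L) (ht' : t' ∈ L) :
    (discreteGaussian L s c).toOuterMeasure {x | (x : E) - t ∈ L'} ≤
      ENNReal.ofReal ((1 + ε) / (1 - ε)) * (discreteGaussian L s c).toOuterMeasure {x | (x : E) - t' ∈ L'} := by
  rw [discreteGaussian_toOuterMeasure_coset L L' hL hs c ht,
    discreteGaussian_toOuterMeasure_coset L L' hL hs c ht', ← mul_assoc]
  refine mul_le_mul' ?_ le_rfl
  -- `ρ_{s,c-t}(L') ≤ ρ_s(L') ≤ (1+ε)/(1-ε) · ρ_{s,c-t'}(L')`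
  have hup : gaussianMass s (c - t) (L' : Set E) ≤ gaussianMass s 0 (L' : Set E) :=
    gaussianMass_le_gaussianMass_zero_of_discrete L' hs (c - t)
  have hlow : ENNReal.ofReal ((1 - ε) / (1 + ε)) * gaussianMass s 0 (L' : Set E) ≤
      gaussianMass s (c - t') (L' : Set E) :=
    ofReal_mul_gaussianMass_lattice_le L' hε hs hηs (c - t')
  have hr : (0 : ℝ) < (1 - ε) / (1 + ε) := div_pos (by linarith) (by linarith)
  have hinv : ENNReal.ofReal ((1 + ε) / (1 - ε)) = (ENNReal.ofReal ((1 - ε) / (1 + ε)))⁻¹ := by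
    rw [← ENNReal.ofReal_inv_of_pos hr, inv_div]
  refine hup.trans ?_
  rw [hinv]
  exact (ENNReal.mul_le_iff_le_inv (by rwa [ne_eq, ENNReal.ofReal_eq_zero, not_le]) ENNReal.ofReal_ne_top).1 hlow


/-! ### From pairwise comparison to near-uniformity over a system of representatives -/

omit [InnerProductSpace ℝ E] [FiniteDimensional ℝ E] [MeasurableSpace E] [BorelSpace E] [DiscreteTopology L]
  [DiscreteTopology L'] [IsZLattice ℝ L'] in
/-- If finitely many cosets `tᵢ + L'` partition `L`, their probabilities under any law on `L` sum to `1`.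
[folklore] -/
theorem sum_toOuterMeasure_cosets_eq_one (p : PMF L) {ι : Type*} [Fintype ι] (t : ι → E)
    (hdisj : Pairwise fun i j => Disjoint {x : L | (x : E) - t i ∈ L'} {x : L | (x : E) - t j ∈ L'})
    (hcover : ∀ x : L, ∃ i, (x : E) - t i ∈ L') :
    ∑ i, p.toOuterMeasure {x : L | (x : E) - t i ∈ L'} = 1 := by
  letI : MeasurableSpace L := ⊤
  have hmeas : ∀ i, MeasurableSet {x : L | (x : E) - t i ∈ L'} := fun _ => MeasurableSpace.measurableSet_top
  have hunion : (⋃ i, {x : L | (x : E) - t i ∈ L'}) = Set.univ :=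
    Set.eq_univ_of_forall fun x => Set.mem_iUnion.2 (hcover x)
  calc ∑ i, p.toOuterMeasure {x : L | (x : E) - t i ∈ L'}
      = ∑ i, p.toMeasure {x : L | (x : E) - t i ∈ L'} :=
        Finset.sum_congr rfl fun i _ => (p.toMeasure_apply_eq_toOuterMeasure_apply (hmeas i)).symm
    _ = p.toMeasure (⋃ i, {x : L | (x : E) - t i ∈ L'}) := by
        rw [← tsum_fintype (L := SummationFilter.unconditional _), measure_iUnion hdisj hmeas]
    _ = 1 := by rw [hunion, measure_univ]

/-- Finitely many masses summing to `1`, each at most `K` times any other, all lie in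
`[(K·N)⁻¹, K/N]` (`N` their number). [folklore] -/
theorem le_div_card_and_inv_le_of_le_mul {ι : Type*} [Fintype ι] {p : ι → ℝ≥0∞} {K : ℝ≥0∞} (hK : K ≠ 0)
    (hsum : ∑ i, p i = 1) (hratio : ∀ i j, p i ≤ K * p j) (i : ι) :
    p i ≤ K / Fintype.card ι ∧ (K * Fintype.card ι)⁻¹ ≤ p i := by
  have hcard : (Fintype.card ι : ℝ≥0∞) ≠ 0 := by
    haveI : Nonempty ι := ⟨i⟩
    exact_mod_cast Fintype.card_ne_zero
  have hcardt : (Fintype.card ι : ℝ≥0∞) ≠ ∞ := ENNReal.natCast_ne_top _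
  have h1 : (Fintype.card ι : ℝ≥0∞) * p i ≤ K := by
    calc (Fintype.card ι : ℝ≥0∞) * p i = ∑ _j : ι, p i := by
          rw [Finset.sum_const, Finset.card_univ, nsmul_eq_mul]
      _ ≤ ∑ j, K * p j := Finset.sum_le_sum fun j _ => hratio i j
      _ = K := by rw [← Finset.mul_sum, hsum, mul_one]
  have h2 : 1 ≤ (Fintype.card ι : ℝ≥0∞) * (K * p i) := by
    calc (1 : ℝ≥0∞) = ∑ j, p j := hsum.symm
      _ ≤ ∑ _j : ι, K * p i := Finset.sum_le_sum fun j _ => hratio j i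
      _ = (Fintype.card ι : ℝ≥0∞) * (K * p i) := by
          rw [Finset.sum_const, Finset.card_univ, nsmul_eq_mul]
  constructor
  · rw [ENNReal.le_div_iff_mul_le (Or.inl hcard) (Or.inl hcardt), mul_comm]
    exact h1
  · have hpi : p i ≠ 0 := by
      intro h0
      rw [h0, mul_zero, mul_zero] at h2
      exact absurd h2 (not_le.2 zero_lt_one)
    rw [ENNReal.inv_le_iff_le_mul (fun _ => mul_ne_zero hK hcard) (fun _ => hpi)]
    calc (1 : ℝ≥0∞) ≤ (Fintype.card ι : ℝ≥0∞) * (K * p i) := h2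
      _ = K * (Fintype.card ι : ℝ≥0∞) * p i := by ring


/-- **Cosets of a smooth sublattice are almost uniformly distributed** (absolute form): under the
hypotheses of `discreteGaussian_coset_le_mul_coset`, if `t₁, …, t_N ∈ L` represent a partition of `L`
into cosets of `L'` (e.g. `L' = qL`, `N = qⁿ`, representatives `∑ aᵢbᵢ`, `a ∈ {0,…,q-1}ⁿ`), then every
coset has probability in `[((1+ε)/(1-ε) · N)⁻¹, (1+ε)/(1-ε) · N⁻¹]` under `D_{L,s,c}` — within a factor
`1 + 2ε/(1-ε)` of uniform. (The use of Claim 3.8 in Regev's proof of Lemma 3.4, arXiv v. p. 18: "the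
statistical distance between the distribution of `a` and the uniform distribution is negligible";
Peikert 2009 p. 11: "`a` is essentially uniform over `ℤ_qⁿ` since `r ≥ q · η_ε(Λ)`".)
[cite: RegevLWE2009, proof of Lemma 3.4 (arXiv v. p. 18) with Claim 3.8] -/
theorem discreteGaussian_coset_near_uniform (hL : L' ≤ L) {ε s : ℝ} (hε : 0 < ε) (hε1 : ε < 1) (hs : 0 < s)
    (hηs : smoothingParameter L' ε ≤ s) (c : E) {ι : Type*} [Fintype ι] (t : ι → E) (ht : ∀ i, t i ∈ L)
    (hdisj : Pairwise fun i j => Disjoint {x : L | (x : E) - t i ∈ L'} {x : L | (x : E) - t j ∈ L'})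
    (hcover : ∀ x : L, ∃ i, (x : E) - t i ∈ L') (i : ι) :
    (discreteGaussian L s c).toOuterMeasure {x : L | (x : E) - t i ∈ L'} ≤
        ENNReal.ofReal ((1 + ε) / (1 - ε)) / Fintype.card ι ∧
      (ENNReal.ofReal ((1 + ε) / (1 - ε)) * Fintype.card ι)⁻¹ ≤
        (discreteGaussian L s c).toOuterMeasure {x : L | (x : E) - t i ∈ L'} := by
  refine le_div_card_and_inv_le_of_le_mul ?_
    (sum_toOuterMeasure_cosets_eq_one L L' (discreteGaussian L s c) t hdisj hcover)
    (fun i j => discreteGaussian_coset_le_mul_coset L L' hL hε hε1 hs hηs c (ht i) (ht j)) i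
  rw [ne_eq, ENNReal.ofReal_eq_zero, not_le]
  exact div_pos (by linarith) (by linarith)

end Literature.Algebra.EuclideanLattices

end
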